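import Mathlib.Analysis.Calculus.BumpFunction.InnerProduct
import Mathlib.Analysis.Calculus.BumpFunction.Normed
import Literature.NumberTheory.LFunctions.WeilExplicitProofs
import Literature.NumberTheory.LFunctions.WeilMellinInversion
import HarnessLib

/-!
# Rudnick–Sarnak `n`-level correlations for `ζ`, I: the smoothing kernel

Sibling file of `Literature/NumberTheory/LFunctions/RudnickSarnak.lean` (the named fact
`Literature.NumberTheory.LFunctions.rudnick_sarnak_unrestricted`, Rudnick–Sarnak 1996, Theorem 3.2
for `ζ`). This is the first file of the general-level (`n ≥ 3`) machinery; it fixes, once and for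
all, the smoothing kernel through which the Guinand–Weil explicit formula
(`Literature.NumberTheory.LFunctions.explicit_formula_holds`) is applied in each of the `n`
variables.

## The kernel (Rudnick–Sarnak 1996, §3, (3.3)–(3.4): "`h_j(r) = ∫ g_j(u) e^{iru} du` with
`g_j ∈ C_c^∞(ℝ)`"; here one fixed `g₀` for every slot, of the positive-definite form `φ ⋆ φ̃`)

* `RudnickSarnakN.bump = φ`: the standard smooth bump on `ℝ` (Mathlib's `ContDiffBump 0` with
  radii `1/16 < 1/8`), viewed as a complex test function: smooth, even, `0 ≤ φ ≤ 1`,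
  `supp φ ⊆ [-1/8, 1/8]`.
* `RudnickSarnakN.g0 = g₀ := φ ⋆ φ̃` (`weilConv`, `weilReflect` of `WeilExplicit.lean`): a Weil test
  function (`IsWeilTest`), real, even, non-negative, supported in `[-1/4, 1/4]`, with `g₀(0) > 0`.
* `RudnickSarnakN.ker = κ`, `κ(r) := ĝ₀(1/2 + ir) = ∫ g₀(v) e^{irv} dv` (the transform
  `weilMellin` of `WeilExplicit.lean` on the critical line): `κ(r) = |φ̂(1/2 + ir)|² ≥ 0`
  (`weilMellin_weilQuadratic_of_re_eq`), even, `κ(0) > 0`, `κ(r) ≤ C/(1 + r²)²`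
  (two integrations by parts, `norm_weilMellin_le` applied to `g₀` and `g₀''`), and
  `0 ≤ κ(0) - κ(r) ≤ κ(0) r²/32`.

In the later files the zeros are windowed by `κ(t - γ)` and the window is averaged over
`t ∈ [0, T]` (after Montgomery 1973), so that the explicit formula is only ever applied to the
honest test functions `u ↦ g₀(u - log x) e^{-itu}`.

## References

* Z. Rudnick, P. Sarnak, *Zeros of principal `L`-functions and random matrix theory*, Duke Math.
  J. 81 (1996), 269–322, §3.
* H. L. Montgomery, *The pair correlation of zeros of the zeta function*, Proc. Sympos. Pure
  Math. 24 (1973), 181–193.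
-/

noncomputable section

open Complex Filter Set MeasureTheory
open scoped Real Topology ComplexConjugate

namespace Literature.NumberTheory.LFunctions

namespace RudnickSarnakN

/-! ## The bump `φ` -/

/-- The real bump: Mathlib's smooth bump function centred at `0` with inner radius `1/16` and
outer radius `1/8` (equal to `1` on `[-1/16, 1/16]`, supported in `[-1/8, 1/8]`). [folklore] -/
def bumpR : ContDiffBump (0 : ℝ) := ⟨1 / 16, 1 / 8, by norm_num, by norm_num⟩

/-- The bump `φ` as a complex-valued test function on `ℝ`. [folklore] -/
def bump (t : ℝ) : ℂ := ((bumpR t : ℝ) : ℂ)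

/-- `Re φ = φ`. [folklore] -/
@[simp] theorem bump_re (t : ℝ) : (bump t).re = bumpR t := by simp [bump]

/-- `Im φ = 0`. [folklore] -/
@[simp] theorem bump_im (t : ℝ) : (bump t).im = 0 := by simp [bump]

/-- `φ` is a Weil test function (smooth with compact support). [folklore] -/
theorem bump_isWeilTest : IsWeilTest bump :=
  ⟨Complex.ofRealCLM.contDiff.comp bumpR.contDiff,
    bumpR.hasCompactSupport.comp_left Complex.ofReal_zero⟩

/-- `φ` is continuous. [folklore] -/
theorem continuous_bump : Continuous bump :=
  Complex.continuous_ofReal.comp bumpR.continuous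

/-- `φ` is even. [folklore] -/
theorem bump_neg (t : ℝ) : bump (-t) = bump t := by
  simp [bump, bumpR.neg]

/-- `φ ≥ 0`. [folklore] -/
theorem bumpR_nonneg (t : ℝ) : 0 ≤ bumpR t := bumpR.nonneg

/-- `φ ≤ 1`. [folklore] -/
theorem bumpR_le_one (t : ℝ) : bumpR t ≤ 1 := bumpR.le_one

/-- `φ(t) = 0` for `|t| ≥ 1/8`. [folklore] -/
theorem bumpR_eq_zero {t : ℝ} (ht : 1 / 8 ≤ |t|) : bumpR t = 0 :=
  bumpR.zero_of_le_dist (by simpa [bumpR, Real.dist_eq] using ht)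

/-- `φ(t) = 0` for `|t| ≥ 1/8` (complex form). [folklore] -/
theorem bump_eq_zero {t : ℝ} (ht : 1 / 8 ≤ |t|) : bump t = 0 := by
  simp [bump, bumpR_eq_zero ht]

/-- `φ` is real: `conj φ(t) = φ(t)`. [folklore] -/
theorem conj_bump (t : ℝ) : conj (bump t) = bump t := by
  simp [bump, Complex.conj_ofReal]

/-- `φ̃ = φ` (`φ` is real and even). [folklore] -/
theorem weilReflect_bump : weilReflect bump = bump := by
  funext t
  simp [weilReflect, bump_neg, conj_bump]

/-- `∫ φ > 0`. [folklore] -/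
theorem integral_bumpR_pos : 0 < ∫ t, bumpR t := bumpR.integral_pos

/-- `∫ φ` as a complex number is the real number `∫ φ`. [folklore] -/
theorem integral_bump : ∫ t, bump t = ((∫ t, bumpR t : ℝ) : ℂ) := by
  unfold bump; exact integral_complex_ofReal

/-! ## The test function `g₀ = φ ⋆ φ̃` -/

/-- `g₀ := φ ⋆ φ̃` (additive autocorrelation of the bump), a Weil test function of positive type.
(Rudnick–Sarnak 1996, (3.4): the `g_j ∈ C_c^∞`; Bombieri 2000 §3: kernels `g ⋆ g̃`.)
[cite: RudnickSarnak1996, (3.4)] -/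
def g0 : ℝ → ℂ := weilConv bump (weilReflect bump)

/-- `g₀` is a Weil test function. [folklore] -/
theorem g0_isWeilTest : IsWeilTest g0 :=
  bump_isWeilTest.weilConv bump_isWeilTest.weilReflect

/-- `g₀` is continuous. [folklore] -/
theorem continuous_g0 : Continuous g0 := g0_isWeilTest.1.continuous

/-- `g₀(v) = ∫ φ(u) φ(v - u) du`. [folklore] -/
theorem g0_apply (v : ℝ) : g0 v = ∫ u, bump u * bump (v - u) := by
  rw [g0, weilReflect_bump, weilConv_apply]

/-- `g₀(v)` is the real number `∫ φ(u) φ(v - u) du`. [folklore] -/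
theorem g0_eq_ofReal (v : ℝ) : g0 v = ((∫ u, bumpR u * bumpR (v - u) : ℝ) : ℂ) := by
  rw [g0_apply, ← integral_complex_ofReal]
  congr 1 with u
  simp [bump]

/-- `Im g₀ = 0`. [folklore] -/
@[simp] theorem g0_im (v : ℝ) : (g0 v).im = 0 := by
  rw [g0_eq_ofReal, Complex.ofReal_im]

/-- `Re g₀(v) = ∫ φ(u) φ(v - u) du`. [folklore] -/
theorem g0_re (v : ℝ) : (g0 v).re = ∫ u, bumpR u * bumpR (v - u) := by
  rw [g0_eq_ofReal, Complex.ofReal_re]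

/-- `g₀` is real: `g₀(v) = Re g₀(v)`. [folklore] -/
theorem g0_eq_re (v : ℝ) : g0 v = ((g0 v).re : ℂ) := by
  rw [g0_re, g0_eq_ofReal]

/-- `conj g₀ = g₀`. [folklore] -/
theorem conj_g0 (v : ℝ) : conj (g0 v) = g0 v := by
  rw [g0_eq_re v, Complex.conj_ofReal]

/-- `g₀ ≥ 0`. [folklore] -/
theorem g0_re_nonneg (v : ℝ) : 0 ≤ (g0 v).re := by
  rw [g0_re]
  exact integral_nonneg fun u ↦ mul_nonneg (bumpR_nonneg u) (bumpR_nonneg _)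

/-- `‖g₀(v)‖ = Re g₀(v)`. [folklore] -/
theorem norm_g0 (v : ℝ) : ‖g0 v‖ = (g0 v).re := by
  rw [g0_eq_re v, Complex.norm_real, Real.norm_of_nonneg (g0_re_nonneg v), Complex.ofReal_re]

/-- `g₀` is even. [folklore] -/
theorem g0_neg (v : ℝ) : g0 (-v) = g0 v := by
  rw [g0_eq_ofReal, g0_eq_ofReal]
  congr 1
  have h := integral_sub_right_eq_self (μ := (volume : Measure ℝ))
    (fun u : ℝ ↦ bumpR u * bumpR (-v - u)) v
  rw [← h]
  congr 1 with u
  have e1 : bumpR (u - v) = bumpR (v - u) := by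
    rw [← bumpR.neg (u - v), neg_sub]
  have e2 : -v - (u - v) = -u := by ring
  rw [e2, bumpR.neg, e1, mul_comm]

/-- `g₀(v) = 0` for `|v| ≥ 1/4` (the supports `|u| < 1/8`, `|v - u| < 1/8` are incompatible).
[folklore] -/
theorem g0_eq_zero {v : ℝ} (hv : 1 / 4 ≤ |v|) : g0 v = 0 := by
  rw [g0_eq_ofReal]
  have : (fun u : ℝ ↦ bumpR u * bumpR (v - u)) = fun _ ↦ 0 := by
    funext u
    by_cases hu : 1 / 8 ≤ |u|
    · rw [bumpR_eq_zero hu, zero_mul]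
    · have : 1 / 8 ≤ |v - u| := by
        have h1 := abs_sub_abs_le_abs_sub v u
        push Not at hu
        linarith
      rw [bumpR_eq_zero this, mul_zero]
  rw [this, integral_zero, Complex.ofReal_zero]

/-- The support of `g₀` lies in `[-1/4, 1/4]`. [folklore] -/
theorem tsupport_g0_subset : tsupport g0 ⊆ Icc (-(1 / 4)) (1 / 4) := by
  refine closure_minimal (fun v hv ↦ ?_) isClosed_Icc
  rw [Function.mem_support] at hv
  by_contra h
  apply hv
  apply g0_eq_zero
  rw [mem_Icc, not_and_or, not_le, not_le] at h
  rcases h with h | h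
  · rw [abs_of_neg (by linarith)]; linarith
  · rw [abs_of_pos (by linarith)]; linarith

/-- `g₀(0) = ∫ φ² > 0`. [folklore] -/
theorem g0_zero_re_pos : 0 < (g0 0).re := by
  rw [g0_re]
  simp only [zero_sub, bumpR.neg]
  have hcont : Continuous fun u : ℝ ↦ bumpR u * bumpR u := bumpR.continuous.mul bumpR.continuous
  have hsupp : HasCompactSupport fun u : ℝ ↦ bumpR u * bumpR u :=
    bumpR.hasCompactSupport.mul_right
  rw [integral_pos_iff_support_of_nonneg (fun u ↦ mul_nonneg (bumpR_nonneg u) (bumpR_nonneg u))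
    (hcont.integrable_of_hasCompactSupport hsupp)]
  have hsub : Metric.ball (0 : ℝ) (1 / 8) ⊆ Function.support fun u : ℝ ↦ bumpR u * bumpR u := by
    intro u hu
    rw [Function.mem_support]
    have : 0 < bumpR u := bumpR.pos_of_mem_ball (by simpa [bumpR] using hu)
    positivity
  exact lt_of_lt_of_le (Metric.measure_ball_pos volume (0 : ℝ) (by norm_num)) (measure_mono hsub)

/-- `0 < ‖g₀(0)‖`. [folklore] -/
theorem norm_g0_zero_pos : 0 < ‖g0 0‖ := by
  rw [norm_g0]; exact g0_zero_re_pos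

/-- The mass `∫ φ` of the bump. [folklore] -/
def bumpMass : ℝ := ∫ t, bumpR t

/-- `∫ φ > 0`. [folklore] -/
theorem bumpMass_pos : 0 < bumpMass := integral_bumpR_pos

/-- `Re g₀(v) ≤ ∫ φ` (since `0 ≤ φ ≤ 1`). [folklore] -/
theorem g0_re_le (v : ℝ) : (g0 v).re ≤ bumpMass := by
  rw [g0_re, bumpMass]
  refine integral_mono_of_nonneg (Eventually.of_forall fun u ↦ mul_nonneg (bumpR_nonneg u) (bumpR_nonneg _))
    (bumpR.continuous.integrable_of_hasCompactSupport bumpR.hasCompactSupport)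
    (Eventually.of_forall fun u ↦ ?_)
  simpa using mul_le_mul_of_nonneg_left (bumpR_le_one (v - u)) (bumpR_nonneg u)

/-- `‖g₀(v)‖ ≤ ∫ φ`. [folklore] -/
theorem norm_g0_le (v : ℝ) : ‖g0 v‖ ≤ bumpMass := by
  rw [norm_g0]; exact g0_re_le v

/-- `Re ∫ f = ∫ Re f` for integrable `f : ℝ → ℂ`. [folklore] -/
theorem re_integral_eq {f : ℝ → ℂ} (hf : Integrable f) : (∫ x, f x).re = ∫ x, (f x).re := by
  have h := ContinuousLinearMap.integral_comp_comm Complex.reCLM hf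
  simpa using h.symm

/-- `g₀` is integrable. [folklore] -/
theorem integrable_g0 : Integrable g0 :=
  continuous_g0.integrable_of_hasCompactSupport g0_isWeilTest.2

/-! ## The kernel `κ(r) = ĝ₀(1/2 + ir)` -/

/-- The window kernel `κ(r) := Re ĝ₀(1/2 + ir) = ∫ g₀(v) cos(rv) dv`; in fact `ĝ₀(1/2 + ir)` is
real and equals `|φ̂(1/2 + ir)|²` (`ker_eq_normSq`). (Rudnick–Sarnak 1996, (3.4): `h = ĝ`.)
[cite: RudnickSarnak1996, (3.4)] -/
def ker (r : ℝ) : ℝ := (weilMellin g0 (1 / 2 + r * I)).re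

/-- `ĝ₀(1/2 + ir) = |φ̂(1/2 + ir)|²`. [folklore] -/
theorem weilMellin_g0_eq_normSq (r : ℝ) :
    weilMellin g0 (1 / 2 + r * I) = (Complex.normSq (weilMellin bump (1 / 2 + r * I)) : ℂ) :=
  weilMellin_weilQuadratic_of_re_eq bump_isWeilTest (by simp)

/-- `κ(r) = |φ̂(1/2 + ir)|²`. [folklore] -/
theorem ker_eq_normSq (r : ℝ) : ker r = Complex.normSq (weilMellin bump (1 / 2 + r * I)) := by
  rw [ker, weilMellin_g0_eq_normSq, Complex.ofReal_re]

/-- `ĝ₀(1/2 + ir) = κ(r)` (the transform is real on the critical line). [folklore] -/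
theorem weilMellin_g0_half (r : ℝ) : weilMellin g0 (1 / 2 + r * I) = (ker r : ℂ) := by
  rw [ker_eq_normSq, weilMellin_g0_eq_normSq]

/-- `κ ≥ 0`. [folklore] -/
theorem ker_nonneg (r : ℝ) : 0 ≤ ker r := by
  rw [ker_eq_normSq]; exact Complex.normSq_nonneg _

/-- `κ(r) = ∫ g₀(v) e^{irv} dv`. [folklore] -/
theorem ker_eq_integral (r : ℝ) : (ker r : ℂ) = ∫ v : ℝ, g0 v * cexp (r * v * I) := by
  rw [← weilMellin_g0_half, weilMellin]
  congr 1 with v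
  congr 2
  ring

/-- `κ` is even (`g₀` is even: `ĝ₀(s) = ĝ₀(1 - s)`). [folklore] -/
theorem ker_neg (r : ℝ) : ker (-r) = ker r := by
  have h : weilMellin g0 (1 / 2 + ((-r : ℝ) : ℂ) * I) = weilMellin g0 (1 / 2 + r * I) := by
    have h1 := weilMellin_comp_neg g0 (1 / 2 + r * I)
    have h2 : (fun t ↦ g0 (-t)) = g0 := funext g0_neg
    rw [h2] at h1
    rw [h1]
    congr 1
    push_cast
    ring
  rw [ker, ker, h]

/-- `κ(0) = ∫ g₀ = (∫ φ)² > 0`. [folklore] -/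
theorem ker_zero_pos : 0 < ker 0 := by
  rw [ker_eq_normSq, Complex.normSq_pos]
  have : weilMellin bump (1 / 2 + (0 : ℝ) * I) = ((∫ t, bumpR t : ℝ) : ℂ) := by
    rw [weilMellin, ← integral_bump]
    congr 1 with t
    simp
  rw [this, Ne, Complex.ofReal_eq_zero]
  exact integral_bumpR_pos.ne'

/-- `κ(0) = ∫ g₀ = Re ĝ₀(1/2)`. [folklore] -/
theorem ker_zero_eq : (ker 0 : ℂ) = ∫ v : ℝ, g0 v := by
  rw [ker_eq_integral]
  congr 1 with v
  simp

/-- `κ` is continuous. [folklore] -/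
theorem continuous_ker : Continuous ker := by
  have h : Continuous fun r : ℝ ↦ weilMellin g0 (1 / 2 + r * I) :=
    (continuous_weilMellin continuous_g0 g0_isWeilTest.2).comp (by fun_prop)
  exact Complex.continuous_re.comp h

/-- `κ(r) ≤ κ(0)` (`|κ(r)| ≤ ∫ |g₀| = ∫ g₀ = κ(0)`). [folklore] -/
theorem ker_le_ker_zero (r : ℝ) : ker r ≤ ker 0 := by
  have h1 : ‖(ker r : ℂ)‖ ≤ ∫ v : ℝ, ‖g0 v * cexp (r * v * I)‖ := by
    rw [ker_eq_integral]; exact norm_integral_le_integral_norm _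
  have h2 : ∫ v : ℝ, ‖g0 v * cexp (r * v * I)‖ = ∫ v : ℝ, (g0 v).re := by
    congr 1 with v
    rw [norm_mul, show (r : ℂ) * v * I = ((r * v : ℝ) : ℂ) * I by push_cast; ring,
      Complex.norm_exp_ofReal_mul_I, mul_one, norm_g0]
  have h3 : (∫ v : ℝ, (g0 v).re) = ker 0 := by
    have := congrArg Complex.re ker_zero_eq
    rw [Complex.ofReal_re, re_integral_eq integrable_g0] at this
    exact this.symm
  rw [h2, h3, Complex.norm_real, Real.norm_eq_abs] at h1
  exact (le_abs_self _).trans h1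

/-- **Decay of the kernel**: `κ(r) ≤ C/(1 + r²)²` (two integrations by parts twice:
`norm_weilMellin_le` for `g₀` and for `g₀''`, `(g₀'')^(s) = (s - 1/2)² ĝ₀(s)`). [folklore] -/
theorem exists_ker_le : ∃ C : ℝ, 0 < C ∧ ∀ r : ℝ, ker r ≤ C / (1 + r ^ 2) ^ 2 := by
  set C₁ := weilDecayConst g0
  set C₂ := weilDecayConst (deriv (deriv g0))
  refine ⟨C₁ + C₂ + 1, by linarith [weilDecayConst_nonneg g0, weilDecayConst_nonneg (deriv (deriv g0))],
    fun r ↦ ?_⟩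
  have hs0 : (0 : ℝ) ≤ (1 / 2 + r * I : ℂ).re := by simp
  have hs1 : (1 / 2 + r * I : ℂ).re ≤ 1 := by norm_num [Complex.add_re]
  have him : (1 / 2 + r * I : ℂ).im = r := by simp
  have h1 : ‖weilMellin g0 (1 / 2 + r * I)‖ ≤ C₁ / (1 + r ^ 2) := by
    have := norm_weilMellin_le g0_isWeilTest hs0 hs1; rwa [him] at this
  have h2 : ‖weilMellin (deriv (deriv g0)) (1 / 2 + r * I)‖ ≤ C₂ / (1 + r ^ 2) := by
    have := norm_weilMellin_le g0_isWeilTest.deriv.deriv hs0 hs1; rwa [him] at this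
  rw [weilMellin_deriv_deriv g0_isWeilTest, norm_mul] at h2
  have e : ‖((1 / 2 + r * I : ℂ) - 1 / 2) ^ 2‖ = r ^ 2 := by
    rw [show (1 / 2 + r * I : ℂ) - 1 / 2 = r * I by ring, norm_pow, norm_mul, Complex.norm_I,
      mul_one, Complex.norm_real, Real.norm_eq_abs, sq_abs]
  rw [e, weilMellin_g0_half] at h2
  rw [weilMellin_g0_half] at h1
  rw [Complex.norm_real, Real.norm_of_nonneg (ker_nonneg r)] at h1 h2
  have hpos : 0 < 1 + r ^ 2 := by positivity
  rw [le_div_iff₀ (by positivity)]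
  have h3 : (1 + r ^ 2) * ker r ≤ (C₁ + C₂) / (1 + r ^ 2) := by
    rw [add_div]; linarith
  rw [le_div_iff₀ hpos] at h3
  have hk := ker_nonneg r
  nlinarith

/-- **The kernel near `0`**: `0 ≤ κ(0) - κ(r) ≤ κ(0) r²/32`
(`κ(0) - κ(r) = ∫ g₀(v)(1 - cos rv) dv`, `0 ≤ 1 - cos rv ≤ (rv)²/2 ≤ r²/32` on `supp g₀`).
[folklore] -/
theorem ker_zero_sub_ker_le (r : ℝ) : ker 0 - ker r ≤ ker 0 * r ^ 2 / 32 := by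
  have hint : Integrable fun v : ℝ ↦ g0 v := integrable_g0
  have hint2 : Integrable fun v : ℝ ↦ g0 v * cexp (r * v * I) :=
    (continuous_g0.mul (by fun_prop)).integrable_of_hasCompactSupport g0_isWeilTest.2.mul_right
  -- `κ(0) - κ(r) = ∫ Re g₀(v) (1 - cos (r v))`
  have hdiff : ker 0 - ker r = ∫ v : ℝ, (g0 v).re * (1 - Real.cos (r * v)) := by
    have e : ((ker 0 - ker r : ℝ) : ℂ) = ∫ v : ℝ, g0 v * (1 - cexp (r * v * I)) := by
      push_cast
      rw [ker_zero_eq, ker_eq_integral, ← integral_sub hint hint2]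
      congr 1 with v; ring
    have e2 : (∫ v : ℝ, g0 v * (1 - cexp (r * v * I))).re = ∫ v : ℝ, (g0 v).re * (1 - Real.cos (r * v)) := by
      rw [re_integral_eq ((hint.sub hint2).congr (Eventually.of_forall fun v ↦ by simp [mul_sub]))]
      congr 1 with v
      rw [show (r : ℂ) * v * I = ((r * v : ℝ) : ℂ) * I by push_cast; ring, Complex.mul_re,
        Complex.sub_re, Complex.sub_im, Complex.one_re, Complex.one_im, Complex.exp_ofReal_mul_I_re,
        Complex.exp_ofReal_mul_I_im, g0_im]
      ring
    have := congrArg Complex.re e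
    rw [Complex.ofReal_re] at this
    rw [this, e2]
  rw [hdiff]
  have hk0 : ker 0 = ∫ v : ℝ, (g0 v).re := by
    have := congrArg Complex.re ker_zero_eq
    rwa [Complex.ofReal_re, re_integral_eq integrable_g0] at this
  calc ∫ v : ℝ, (g0 v).re * (1 - Real.cos (r * v))
      ≤ ∫ v : ℝ, (g0 v).re * (r ^ 2 / 32) := by
        refine integral_mono_of_nonneg (Eventually.of_forall fun v ↦ mul_nonneg (g0_re_nonneg v)
          (by linarith [Real.cos_le_one (r * v)])) ((hint.re).mul_const _) (Eventually.of_forall fun v ↦ ?_)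
        by_cases hv : 1 / 4 ≤ |v|
        · simp [g0_eq_zero hv]
        · push Not at hv
          refine mul_le_mul_of_nonneg_left ?_ (g0_re_nonneg v)
          have hc := Real.one_sub_sq_div_two_le_cos (x := r * v)
          have : (r * v) ^ 2 ≤ r ^ 2 / 16 := by
            rw [mul_pow]
            have : v ^ 2 ≤ 1 / 16 := by
              have := sq_abs v; nlinarith [abs_nonneg v]
            nlinarith [sq_nonneg r]
          linarith
    _ = ker 0 * r ^ 2 / 32 := by
        rw [integral_mul_const, hk0]; ring

/-- `κ(r) ≥ κ(0)/2` for `|r| ≤ 4`. [folklore] -/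
theorem half_ker_zero_le {r : ℝ} (hr : |r| ≤ 4) : ker 0 / 2 ≤ ker r := by
  have h := ker_zero_sub_ker_le r
  have hr2 : r ^ 2 ≤ 16 := by
    have := sq_abs r; nlinarith [abs_nonneg r]
  nlinarith [ker_zero_pos]

/-! ## The transform of `g₀` off the critical line (polar terms) -/

/-- `‖ĝ₀(σ + it)‖ ≤ C_{g₀}/(1 + t²)` for `0 ≤ σ ≤ 1` (`norm_weilMellin_le`). [folklore] -/
theorem norm_weilMellin_g0_le {σ : ℝ} (h0 : 0 ≤ σ) (h1 : σ ≤ 1) (t : ℝ) :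
    ‖weilMellin g0 (σ + t * I)‖ ≤ weilDecayConst g0 / (1 + t ^ 2) := by
  have := norm_weilMellin_le g0_isWeilTest (s := σ + t * I) (by simpa using h0) (by simpa using h1)
  simpa using this

end RudnickSarnakN

end Literature.NumberTheory.LFunctions

end
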